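import Literature.NumberTheory.DiophantineApproximation.PadicSubspaceTheoremProofs
import Mathlib.NumberTheory.Padics.PadicNorm
import HarnessLib

/-!
# The `p`-adic Subspace Theorem over `ℚ` — the RATIONAL-coefficient, any-finite-`S` form from the catalogued fact

THEOREMS ONLY (no definition, no named fact, no `sorry`).  Companion to `PadicSubspaceTheorem.lean` /
`PadicSubspaceTheoremProofs.lean`.  The tree proves Bugeaud–Corvaja–Zannier 2003, Thm. 1 from an explicitly written-out
hypothesis `hST` = the `p`-adic Subspace Theorem over `ℚ` for integer points with RATIONAL linear forms at `∞` and at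
the primes of a finite set `S`, values measured by `|·|` and `padicNorm p`, hyperplane form
(`Literature.NumberTheory.DiophantineGeometry.BugeaudCorvajaZannier2003_thm1_of_subspaceTheorem`,
`IntegerGCDBoundProofs.lean`).  This file derives exactly that statement from the catalogued named fact
`Schlickewei1976_padicSubspaceTheorem` (Bilu, Sém. Bourbaki 967, Thm. 2.3: algebraic coefficients, `S ∋ ∞` finite):

* `Schlickewei1976_padicSubspaceTheorem.rational_int (h : Schlickewei1976_padicSubspaceTheorem) : hST` — re-index the
  variables `ι ≃ Fin m` (`m = card ι ≥ 2`); read the rational forms at `∞` in `ℂ` and at `p ∈ S` in `\overline{ℚ_p}`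
  (rationals are algebraic; `det ≠ 0` survives a field embedding, so linear independence is kept); identify
  `padicNorm p q` with Mathlib's norm of `q` in `\overline{ℚ_p}` (`Padic.eq_padicNorm`, `PadicAlgCl.norm_extends`)
  and `|q|` with the complex norm of `q`; apply the hyperplane form `.hyperplanes` with the injective family of the
  primes of `S`; pull the finitely many rational linear forms back along the re-indexing.

The domination `Schlickewei1976_padicSubspaceTheorem → BugeaudCorvajaZannier2003_thm1` is the one-liner of
`Literature/NumberTheory/DiophantineGeometry/IntegerGCDBoundOfPadicSubspace.lean`.

References: [Bilu2008] Sém. Bourbaki Exp. 967, Thm. 2.3 (p. 967-04); [BombieriGubler2006] Thm. 7.2.2, Cor. 7.2.5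
(pp. 177–178), 7.3.8; [BugeaudCorvajaZannier2003] Math. Z. 243 (2003) 79–84, Thm. 1.
-/

noncomputable section

open Finset

namespace Literature.NumberTheory.DiophantineApproximation

/-- Rows of a rational square matrix that are linearly independent over `ℚ` stay linearly independent after
re-indexing rows and columns along `e : ι ≃ κ` and embedding `ℚ` into a field `F`. [folklore] -/
private theorem linearIndependent_reindex_map {ι κ F : Type*} [Fintype ι] [DecidableEq ι] [Fintype κ] [DecidableEq κ]
    [Field F] [CharZero F] (e : ι ≃ κ) {L : ι → ι → ℚ} (hL : LinearIndependent ℚ L) :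
    LinearIndependent F (fun a b => (L (e.symm a) (e.symm b) : F)) := by
  have h1 : IsUnit (Matrix.of L) := (Matrix.linearIndependent_rows_iff_isUnit (A := Matrix.of L)).1 hL
  rw [Matrix.isUnit_iff_isUnit_det] at h1
  have h3 : Matrix.of (fun a b => (L (e.symm a) (e.symm b) : F)) =
      (algebraMap ℚ F).mapMatrix (Matrix.reindex e e (Matrix.of L)) := by
    ext a b; simp [Matrix.reindex_apply, Matrix.submatrix_apply]
  have h2 : IsUnit (Matrix.of (fun a b => (L (e.symm a) (e.symm b) : F))) := by
    rw [Matrix.isUnit_iff_isUnit_det, h3, ← RingHom.map_det, Matrix.det_reindex_self, isUnit_iff_ne_zero,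
      map_ne_zero_iff _ (algebraMap ℚ F).injective]
    exact h1.ne_zero
  exact (Matrix.linearIndependent_rows_iff_isUnit (A := Matrix.of (fun a b => (L (e.symm a) (e.symm b) : F)))).2 h2

/-- `|q|` read in `ℂ`: `‖(q : ℂ)‖ = |q|`. [folklore] -/
private theorem norm_ratCast_complex (q : ℚ) : ‖(q : ℂ)‖ = ((|q| : ℚ) : ℝ) := by
  rw [show (q : ℂ) = ((q : ℝ) : ℂ) by push_cast; rfl, Complex.norm_real, Real.norm_eq_abs, Rat.cast_abs]

/-- `|q|_p` read in `\overline{ℚ_p}`: Mathlib's norm of `q` in `PadicAlgCl p` is `padicNorm p q`. [folklore] -/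
private theorem norm_ratCast_padicAlgCl (p : ℕ) [Fact p.Prime] (q : ℚ) :
    ‖(q : PadicAlgCl p)‖ = ((padicNorm p q : ℚ) : ℝ) := by
  have h1 : (q : PadicAlgCl p) = ((q : ℚ_[p]) : PadicAlgCl p) := by
    rw [show ((q : ℚ_[p]) : PadicAlgCl p) = algebraMap ℚ_[p] (PadicAlgCl p) (q : ℚ_[p]) from rfl, map_ratCast]
  rw [h1, PadicAlgCl.norm_extends, Padic.eq_padicNorm]

/-- The sup-norm is invariant under re-indexing. [folklore] -/
private theorem sup_natAbs_reindex {ι κ : Type*} [Fintype ι] [Fintype κ] (e : ι ≃ κ) (x : ι → ℤ) :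
    (Finset.univ.sup fun b => (x (e.symm b)).natAbs) = Finset.univ.sup fun j => (x j).natAbs := by
  apply le_antisymm
  · exact Finset.sup_le fun b _ => Finset.le_sup (f := fun j => (x j).natAbs) (Finset.mem_univ (e.symm b))
  · refine Finset.sup_le fun j _ => ?_
    have := Finset.le_sup (f := fun b => (x (e.symm b)).natAbs) (Finset.mem_univ (e j))
    simpa using this

/-- **The tree's hypothesis `hST` (the `p`-adic Subspace Theorem over `ℚ`, rational forms, integer points, any finite
set `S` of primes, hyperplane form) from the catalogued fact `Schlickewei1976_padicSubspaceTheorem`.**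
[cite: Bilu2008, Thm. 2.3 (p. 967-04)] [cite: BombieriGubler2006, Thm. 7.2.2, Cor. 7.2.5 (pp. 177–178)] -/
theorem Schlickewei1976_padicSubspaceTheorem.rational_int (h : Schlickewei1976_padicSubspaceTheorem) :
    ∀ (ι : Type) [Fintype ι], 1 < Fintype.card ι →
      ∀ (S : Finset ℕ), (∀ p ∈ S, p.Prime) →
      ∀ (L : ι → ι → ℚ), LinearIndependent ℚ L →
      ∀ (M : ℕ → ι → ι → ℚ), (∀ p ∈ S, LinearIndependent ℚ (M p)) →
      ∀ ε : ℝ, 0 < ε →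
        ∃ T : Finset (ι → ℚ), (∀ f ∈ T, f ≠ 0) ∧
          ∀ x : ι → ℤ, x ≠ 0 →
            (((∏ i, |∑ j, L i j * x j|) *
                ∏ p ∈ S, ∏ i, padicNorm p (∑ j, M p i j * x j) : ℚ) : ℝ) <
              ((Finset.univ.sup fun j => (x j).natAbs : ℕ) : ℝ) ^ (-ε) →
            ∃ f ∈ T, ∑ j, f j * x j = 0 := by
  intro ι _ hcard S hS L hL M hM ε hε
  classical
  -- re-index the variables by `Fin m`
  set m : ℕ := Fintype.card ι with hm
  let e : ι ≃ Fin m := Fintype.equivFin ι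
  -- the places: `∞` and the primes of `S` as an injective family
  haveI hF : ∀ k : {p // p ∈ S}, Fact (Nat.Prime ((fun k : {p // p ∈ S} => (k : ℕ)) k)) := fun k => ⟨hS k.1 k.2⟩
  -- the forms, read in `ℂ` and in `\overline{ℚ_p}`
  let L' : Fin m → Fin m → ℂ := fun a b => (L (e.symm a) (e.symm b) : ℂ)
  let M' : (k : {p // p ∈ S}) → Fin m → Fin m → PadicAlgCl (k : ℕ) :=
    fun k a b => (M k (e.symm a) (e.symm b) : PadicAlgCl (k : ℕ))
  have hL'a : ∀ a b, IsAlgebraic ℚ (L' a b) := fun a b => isAlgebraic_algebraMap (L (e.symm a) (e.symm b))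
  have hL'i : LinearIndependent ℂ L' := linearIndependent_reindex_map e hL
  have hM'a : ∀ k a b, IsAlgebraic ℚ (M' k a b) := fun k a b => by
    simpa [M'] using isAlgebraic_algebraMap (R := ℚ) (A := PadicAlgCl (k : ℕ)) (M k (e.symm a) (e.symm b))
  have hM'i : ∀ k : {p // p ∈ S}, LinearIndependent (PadicAlgCl (k : ℕ)) (M' k) := fun k =>
    linearIndependent_reindex_map e (hM k.1 k.2)
  obtain ⟨T', hT'0, hT'⟩ := h.hyperplanes m (by omega) {p // p ∈ S} (fun k => (k : ℕ))
    (fun k k' hkk' => Subtype.ext hkk') L' hL'a hL'i M' hM'a hM'i ε hε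
  -- pull the forms back along `e`
  refine ⟨T'.image fun f => f ∘ e, ?_, ?_⟩
  · intro f hf
    obtain ⟨f', hf', rfl⟩ := Finset.mem_image.1 hf
    intro h0
    apply hT'0 f' hf'
    funext b
    have := congr_fun h0 (e.symm b)
    simpa using this
  · intro x hx hlt
    -- the solution re-indexed
    let x' : Fin m → ℤ := fun b => x (e.symm b)
    have hx' : x' ≠ 0 := by
      intro h0; apply hx; funext j
      have := congr_fun h0 (e j)
      simpa [x'] using this
    have hreal : (∏ a, ‖∑ b, L' a b * (x' b : ℂ)‖) = (((∏ i, |∑ j, L i j * x j|) : ℚ) : ℝ) := by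
      have h1 : ∀ a, ‖∑ b, L' a b * (x' b : ℂ)‖ = ((|∑ j, L (e.symm a) j * x j| : ℚ) : ℝ) := by
        intro a
        have h2 : (∑ b, L' a b * (x' b : ℂ)) = ((∑ j, L (e.symm a) j * x j : ℚ) : ℂ) := by
          push_cast [L', x']
          exact Equiv.sum_comp e.symm (fun j => (L (e.symm a) j : ℂ) * (x j : ℂ))
        rw [h2, norm_ratCast_complex]
      simp_rw [h1]
      rw [← Rat.cast_prod]
      congr 1
      exact Equiv.prod_comp e.symm (fun i => |∑ j, L i j * (x j : ℚ)|)
    have hpadic : (∏ k : {p // p ∈ S}, ∏ a, ‖∑ b, M' k a b * (x' b : PadicAlgCl (k : ℕ))‖) =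
        (((∏ p ∈ S, ∏ i, padicNorm p (∑ j, M p i j * x j)) : ℚ) : ℝ) := by
      have h1 : ∀ (k : {p // p ∈ S}) a, ‖∑ b, M' k a b * (x' b : PadicAlgCl (k : ℕ))‖ =
          ((padicNorm k (∑ j, M k (e.symm a) j * x j) : ℚ) : ℝ) := by
        intro k a
        have h2 : (∑ b, M' k a b * (x' b : PadicAlgCl (k : ℕ))) =
            ((∑ j, M k (e.symm a) j * x j : ℚ) : PadicAlgCl (k : ℕ)) := by
          push_cast [M', x']
          exact Equiv.sum_comp e.symm (fun j => (M k (e.symm a) j : PadicAlgCl (k : ℕ)) * (x j : PadicAlgCl (k : ℕ)))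
        rw [h2, norm_ratCast_padicAlgCl]
      simp_rw [h1]
      rw [Rat.cast_prod, ← Finset.prod_coe_sort S]
      refine Finset.prod_congr rfl fun k _ => ?_
      rw [Rat.cast_prod]
      exact Equiv.prod_comp e.symm (fun i => ((padicNorm k (∑ j, M k i j * x j) : ℚ) : ℝ))
    have hsup : (Finset.univ.sup fun b => (x' b).natAbs) = Finset.univ.sup fun j => (x j).natAbs :=
      sup_natAbs_reindex e x
    have hineq : (∏ a, ‖∑ b, L' a b * (x' b : ℂ)‖) *
        (∏ k : {p // p ∈ S}, ∏ a, ‖∑ b, M' k a b * (x' b : PadicAlgCl (k : ℕ))‖) ≤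
        (((Finset.univ.sup fun b => (x' b).natAbs : ℕ) : ℝ)) ^ (-ε) := by
      rw [hreal, hpadic, hsup, ← Rat.cast_mul]
      exact hlt.le
    obtain ⟨f', hf'T, hf'⟩ := hT' x' hx' hineq
    refine ⟨f' ∘ e, Finset.mem_image_of_mem _ hf'T, ?_⟩
    have : ∑ j, (f' ∘ e) j * (x j : ℚ) = ∑ b, f' b * (x' b : ℚ) := by
      simpa [x'] using Equiv.sum_comp e (fun b => f' b * (x (e.symm b) : ℚ))
    rw [this, hf']

end Literature.NumberTheory.DiophantineApproximation

end
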